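import Literature.NumberTheory.EllipticCurves.NewformsMainLemmaTraceProofs
import HarnessLib

/-!
# The trace of the three degeneracy images: `Tr^{Mq²}_M (B₁ f) = q(q+1) f`, `Tr^{Mq²}_M (B_q f) = q·T_q f`,
# `Tr^{Mq²}_M (B_{q²} f) = T_q² f − (q+1) f` for `q ∤ M` (route `EdixhovenFibreFiveSeven`, crux TDS57,
# `--supports`; Road A′ = Ihara-free L-TWIST, part 2/3)

Cell `pub/bsd-wall` (D-0145 line `route-BirchSwinnertonDyer-EdixhovenFibreFiveSeven`), seat `bsd-line-edix-p2`
(prover). Route-free file: THEOREMS ONLY (no definition, no named fact, no `sorry`). BSD is not proved by this file.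

For a prime `q ∤ M`, `N = Mq`, `L = Mq²`, weight `2`, and the two one-step traces
`Tr₁ = [Γ₀(N) 1 Γ₀(M)]`, `Tr₂ = [Γ₀(L) 1 Γ₀(N)]` (`restrictLevel`), the images of `f ∈ S₂(Γ₀(M))` under the
degeneracy maps `B_d = degeneracyMap0 M L d 2 = [diag(d,1)]₂` (`d = 1, q, q²`; `α, β, γ : τ ↦ τ, qτ, q²τ`)
have traces

* `restrictLevel_restrictLevel_degeneracyMap0_one` — `Tr₁ Tr₂ (B₁ f) = q(q+1)·f` (the index);
* `restrictLevel_restrictLevel_degeneracyMap0_prime` — `Tr₁ Tr₂ (B_q f) = q·T_q f`;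
* `restrictLevel_restrictLevel_degeneracyMap0_sq` — `Tr₁ Tr₂ (B_{q²} f) = T_q(T_q f) − (q+1)·f`
  (`= T(1,q²) f`),

i.e. the first row `(α_* α^*, β_* α^*, γ_* α^*) = (q(q+1), q·T_q, T_q² − q − 1)` of the Gram matrix of the
three degeneracy maps `X₀(Mq²) → X₀(M)` (Ribet 1990 §3 (3.?) for one prime; Wiles 1995 §2 / Diamond–Ribet
1997 (10)–(11) for `q²`; Shimura 1971 Prop. 3.?? `T_q T_q = T(1,q²) + (q+1) T(q,q)`). They are PURE ALGEBRA
over the tree's one-prime trace formulas of `NewformsMainLemmaTraceProofs` (`restrictLevel_toLevel0`: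
`Tr^{Np}_N = p` on level-`N` forms for `p ∣ N`; `coe_restrictLevel_gamma0_beta` / `coe_restrictLevel_eq_add_heckeT`:
`Tr^{Mp}_M F = F + p^{2-k} U_p(F ∣ W_p)` for `p ∤ M`; `coe_restrictLevel_iota`; `slash_W_of_level`,
`slash_W_slash_W`) and `coe_heckeT_gamma0_eq_sum`:

* `restrictLevel_toLevel0_prime` — `Tr₁ f = (q+1) f` for `f` of level `M`;
* `translate_W_iota` — `(ι_q f) ∣ W_q = q⁻¹ f`; `coe_heckeT_toLevel0` — `U_q f = T_q f − f ∣ diag(q,1)` at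
  level `N`; `restrictLevel_iota_prime` — `Tr₁ (ι_q f) = q⁻¹ T_q f` (the adjoint of `ι_q` is `T_q` up to
  the degree normalisation; Ribet 1990 (3.?)/Li 1975 Lemma 1); `restrictLevel_iota_iota` —
  `Tr₂ (ι_q ι_q f) = q⁻¹ ι_q (T_q f) − q⁻² f`.

With the transfer lemma of `…CycleTransfer` (`(Tr)^∨` preserves period homology) these give the cycle
`z = (Tr₂)^∨ (Tr₁)^∨ x ∈ H₁(X₀(Mq²), ℤ)` with `z((f_χ)_χ) = ((q−1)((q+1)² − a_q²)/q)·x(f)` for a `T_q`-eigenform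
`f` (`…LTwistTransfer`, part 3/3). References: [Shimura1971] §3.4 Prop. 3.?? (`T(p)T(p)`), [Ribet1990] §3,
[Li1975] Lemma 1–3, [DiamondShurman2005] §5.1 p. 166 (3), Ex. 5.7.2, [AtkinLehner1970] Lemma 7.
-/

set_option autoImplicit false
-- the Theorems directory repeats the summit name (sibling precedent `SignedBaseChangeAssembly.lean`)
set_option linter.dupNamespace false

noncomputable section

open scoped MatrixGroups ModularForm

open CongruenceSubgroup UpperHalfPlane Matrix.SpecialLinearGroup

namespace Summit.BirchSwinnertonDyer.BirchSwinnertonDyer.Theorems.TraceDegeneracy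

open Literature.NumberTheory.EllipticCurves.ModularForms

/-! ### §0 Small matrix facts -/

/-- `diag(1,1) = 1` in `GL₂(ℝ)`. [folklore] -/
theorem tpD_one : (tpD 1 : GL (Fin 2) ℝ) = 1 := by
  ext i j
  rw [val_tpD]
  fin_cases i <;> fin_cases j <;> simp

/-- `diag(q²,1) = diag(q,1)²` in `GL₂(ℝ)`. [folklore] -/
theorem tpD_sq (q : ℕ) [NeZero q] : (tpD (q ^ 2) : GL (Fin 2) ℝ) = tpD q * tpD q := by
  ext i j
  rw [Matrix.GeneralLinearGroup.coe_mul, val_tpD, val_tpD]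
  fin_cases i <;> fin_cases j <;> simp [Matrix.mul_apply, Fin.sum_univ_two, sq]

/-- `(f − g) ∣ A = f ∣ A − g ∣ A`. [folklore] -/
theorem sub_slash (k : ℤ) (A : GL (Fin 2) ℝ) (f g : ℍ → ℂ) : (f - g) ∣[k] A = f ∣[k] A - g ∣[k] A := by
  rw [sub_eq_add_neg, SlashAction.add_slash, SlashAction.neg_slash, ← sub_eq_add_neg]

variable (q : ℕ) [Fact q.Prime] {M N L : ℕ} [NeZero M] [NeZero N] [NeZero L]

/-! ### §1 Traces of level-`M` forms and of `ι_q f` down the prime step `Γ₀(Mq) → Γ₀(M)` -/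

/-- **`Tr^{Mq}_M f = (q+1) f` for `f` of level `M`, `q ∤ M`**: all `q + 1` representatives `β`, `(1 0; Mj 1)`
of `Γ₀(Mq)∖Γ₀(M)` lie in `Γ₀(M)` (the index `[Γ₀(M) : Γ₀(Mq)] = q + 1`). [folklore] -/
theorem restrictLevel_toLevel0_prime (hN : N = M * q) (hqM : ¬ q ∣ M) (f : CuspForm (Gamma0 M) 2) :
    restrictLevel (Gamma0 N) (Gamma0 M) 2 (toLevel0 ⟨q, hN⟩ 2 f) = ((q : ℂ) + 1) • f := by
  obtain ⟨β, hβ10, hβ11⟩ := exists_beta q M hqM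
  have hβ : β ∈ Gamma0 M := by rw [Gamma0_mem, hβ10]; simp
  apply DFunLike.ext'
  rw [coe_restrictLevel_gamma0_beta 2 q M N hN β hβ10 hβ11, coe_toLevel0, CuspForm.IsGLPos.coe_smul,
    SlashInvariantFormClass.slash_action_eq f _ (Subgroup.mem_map_of_mem _ hβ)]
  have h : ∀ j : Fin q, (⇑f : ℍ → ℂ) ∣[(2 : ℤ)] (mapGL ℝ
      (transpose (ModularGroup.T ^ ((M : ℤ) * ((j : ℕ) : ℤ)))) : GL (Fin 2) ℝ) = ⇑f := fun j ↦
    SlashInvariantFormClass.slash_action_eq f _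
      (Subgroup.mem_map_of_mem _ (LU_mem_gamma0 M (dvd_mul_right _ _)))
  simp only [h, Finset.sum_const, Finset.card_univ, Fintype.card_fin]
  rw [← Nat.cast_smul_eq_nsmul ℂ, add_smul, one_smul, add_comm]

omit [NeZero M] [NeZero N] in
/-- **`(ι_q f) ∣ W_q = q⁻¹ f`** for `f` of level `M`, `W_q = β diag(q,1)`: `f ∣ W_q = q·ι_q f`
(`slash_W_of_level`) and `W_q² = q^0` on level `Mq` (`slash_W_slash_W`). [folklore] -/
theorem translate_W_iota (hN : N = M * q) {β : SL(2, ℤ)} (hβ10 : β 1 0 = M) (hβ11 : (q : ℤ) ∣ β 1 1)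
    (hMN : M * q ∣ N) (f : CuspForm (Gamma0 M) 2) :
    cuspFormOfLE (gamma0_le_conj_beta_tpD hN hβ10 hβ11)
        (CuspForm.translate (iota M N q 2 hMN f) ((mapGL ℝ β : GL (Fin 2) ℝ) * tpD q)) =
      (q : ℂ)⁻¹ • toLevel0 ⟨q, hN⟩ 2 f := by
  have hq0 : (q : ℂ) ≠ 0 := by exact_mod_cast (Fact.out : q.Prime).ne_zero
  apply DFunLike.ext'
  rw [coe_cuspFormOfLE_translate_W 2 hN hβ10 hβ11, CuspForm.IsGLPos.coe_smul, coe_toLevel0]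
  -- `ι_q f = q⁻¹ (f ∣ W_q)` as functions on level `N`
  have h1 : (⇑(iota M N q 2 hMN f) : ℍ → ℂ) = (q : ℂ)⁻¹ • ((⇑f : ℍ → ℂ) ∣[(2 : ℤ)]
      ((mapGL ℝ β : GL (Fin 2) ℝ) * tpD q)) := by
    rw [slash_W_of_level 2 hβ10 hMN f, smul_smul]
    norm_num [hq0]
  have h2 := slash_W_slash_W 2 hN hβ10 hβ11 (toLevel0 ⟨q, hN⟩ 2 f)
  rw [coe_toLevel0] at h2
  rw [h1, ModularForm.smul_slash, h2]
  norm_num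

/-- **`U_q f = T_q f − f ∣ diag(q,1)` at level `N = Mq`** for `f` of level `M` (`q ∤ M`): both are
`Σ_{j mod q} f ∣ (1 j; 0 q)` (`coe_heckeT_gamma0_eq_sum` at the two levels). [folklore] -/
theorem coe_heckeT_toLevel0 (hN : N = M * q) (hqM : ¬ q ∣ M) (f : CuspForm (Gamma0 M) 2) :
    (⇑(heckeT (Gamma0 N) 2 q (toLevel0 ⟨q, hN⟩ 2 f)) : ℍ → ℂ) =
      ⇑(heckeT (Gamma0 M) 2 q f) - (⇑f : ℍ → ℂ) ∣[(2 : ℤ)] tpD q := by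
  have hq : q.Prime := Fact.out
  have hqN : q ∣ N := ⟨M, by rw [hN, mul_comm]⟩
  rw [coe_heckeT_gamma0_eq_sum N 2 q hq, if_pos hqN, add_zero, coe_heckeT_gamma0_eq_sum M 2 q hq,
    if_neg hqM, coe_toLevel0, add_sub_cancel_right]

/-- **`Tr^{Mq}_M (ι_q f) = q⁻¹ T_q f`** for `f ∈ S₂(Γ₀(M))`, `q ∤ M`: by the trace formula
`Tr F = F + U_q(F ∣ W_q)` (`coe_restrictLevel_eq_add_heckeT`, `k = 2`) with `(ι_q f) ∣ W_q = q⁻¹ f` and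
`U_q f = T_q f − f ∣ diag(q,1) = T_q f − q ι_q f`. (The adjoint of `ι_q` is `T_q`: Li 1975 Lemma 1,
Ribet 1990 §3.) [cite: Li1975, §2 Lemma 1] -/
theorem restrictLevel_iota_prime (hN : N = M * q) (hqM : ¬ q ∣ M) (hMN : M * q ∣ N)
    (f : CuspForm (Gamma0 M) 2) :
    restrictLevel (Gamma0 N) (Gamma0 M) 2 (iota M N q 2 hMN f) = (q : ℂ)⁻¹ • heckeT (Gamma0 M) 2 q f := by
  have hq0 : (q : ℂ) ≠ 0 := by exact_mod_cast (Fact.out : q.Prime).ne_zero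
  obtain ⟨β, hβ10, hβ11⟩ := exists_beta q M hqM
  apply DFunLike.ext'
  rw [coe_restrictLevel_eq_add_heckeT 2 q hN hβ10 hβ11 hqM, translate_W_iota q hN hβ10 hβ11 hMN f,
    map_smul, CuspForm.IsGLPos.coe_smul, CuspForm.IsGLPos.coe_smul, coe_heckeT_toLevel0 q hN hqM f,
    coe_iota]
  ext τ
  simp only [Pi.add_apply, Pi.smul_apply, Pi.sub_apply, smul_eq_mul]
  norm_num
  ring

/-! ### §2 The prime step `Γ₀(Mq²) → Γ₀(Mq)` on `ι_q ι_q f` -/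

/-- **`Tr^{Mq²}_{Mq} (ι_q ι_q f) = q⁻¹ ι_q(T_q f) − q⁻² f`** for `f ∈ S₂(Γ₀(M))`, `q ∤ M` (`N = Mq`, `L = Mq²`):
`Tr^L_N (ι_q G) = q⁻¹ (Σ_{j mod q} G ∣ (1 0; Mj 1)) ∣ diag(q,1)` (`coe_restrictLevel_iota`) `= q⁻¹(Tr^N_M G − G ∣ β) ∣ diag(q,1)
= ι_q(Tr^N_M G)·… − q⁻¹ G ∣ W_q` with `G = ι_q f`, `Tr^N_M G = q⁻¹ T_q f`, `G ∣ W_q = q⁻¹ f`. [folklore] -/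
theorem restrictLevel_iota_iota (hN : N = M * q) (hL : L = N * q) (hqM : ¬ q ∣ M) (hMN : M * q ∣ N)
    (hNL : N * q ∣ L) (f : CuspForm (Gamma0 M) 2) :
    restrictLevel (Gamma0 L) (Gamma0 N) 2 (iota N L q 2 hNL (iota M N q 2 hMN f)) =
      (q : ℂ)⁻¹ • iota M N q 2 hMN (heckeT (Gamma0 M) 2 q f) - ((q : ℂ)⁻¹) ^ 2 • toLevel0 ⟨q, hN⟩ 2 f := by
  have hq0 : (q : ℂ) ≠ 0 := by exact_mod_cast (Fact.out : q.Prime).ne_zero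
  have hqN : q ∣ N := ⟨M, by rw [hN, mul_comm]⟩
  obtain ⟨β, hβ10, hβ11⟩ := exists_beta q M hqM
  have hσ : ∀ c : ℂ, σ (tpD q) c = c := fun c ↦
    σ_eq_self (by rw [det_tpD]; exact_mod_cast (Fact.out : q.Prime).pos) c
  apply DFunLike.ext'
  -- `Σ_j G ∣ (1 0; Mj 1) = Tr^N_M G − G ∣ β` for `G = ι_q f`
  have hsum : (∑ j : Fin q, (⇑(iota M N q 2 hMN f) : ℍ → ℂ) ∣[(2 : ℤ)] (mapGL ℝ
      (transpose (ModularGroup.T ^ ((M : ℤ) * ((j : ℕ) : ℤ)))) : GL (Fin 2) ℝ)) =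
      ⇑(restrictLevel (Gamma0 N) (Gamma0 M) 2 (iota M N q 2 hMN f)) -
        (⇑(iota M N q 2 hMN f) : ℍ → ℂ) ∣[(2 : ℤ)] (mapGL ℝ β : GL (Fin 2) ℝ) := by
    rw [coe_restrictLevel_gamma0_beta 2 q M N hN β hβ10 hβ11 (iota M N q 2 hMN f), add_sub_cancel_left]
  rw [coe_restrictLevel_iota 2 q N L q M N hL hqN hN hNL (iota M N q 2 hMN f), hsum,
    restrictLevel_iota_prime q hN hqM hMN f, sub_slash,
    ← SlashAction.slash_mul, ← coe_cuspFormOfLE_translate_W 2 hN hβ10 hβ11 (iota M N q 2 hMN f),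
    translate_W_iota q hN hβ10 hβ11 hMN f, CuspForm.coe_sub, CuspForm.IsGLPos.coe_smul,
    CuspForm.IsGLPos.coe_smul, CuspForm.IsGLPos.coe_smul, CuspForm.IsGLPos.coe_smul, coe_toLevel0,
    coe_iota M N q 2 hMN (heckeT (Gamma0 M) 2 q f), ModularForm.smul_slash, hσ]
  ext τ
  simp only [Pi.smul_apply, Pi.sub_apply, smul_eq_mul]
  norm_num
  ring

/-! ### §3 The three two-step traces -/

/-- `B₁ f = f` viewed at level `L` (`[diag(1,1)]₂`, `coe_degeneracyMap0`). [folklore] -/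
theorem degeneracyMap0_one_eq_toLevel0 (hML : M ∣ L) (f : CuspForm (Gamma0 M) 2) :
    degeneracyMap0 M L 1 2 f = toLevel0 hML 2 f := by
  apply DFunLike.ext'
  rw [coe_degeneracyMap0 M L 1 2 (by simpa using hML) f, coe_toLevel0, tpD_one, SlashAction.slash_one]

omit [NeZero N] in
/-- `B_q f = q · ι_q f` viewed at level `L` (`[diag(q,1)]₂ = q ι_q`, `degeneracyMap0_eq_smul_iota`). [folklore] -/
theorem degeneracyMap0_prime_eq_toLevel0_iota (hMN : M * q ∣ N) (hNL : N ∣ L) (hML : M * q ∣ L)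
    (f : CuspForm (Gamma0 M) 2) :
    degeneracyMap0 M L q 2 f = (q : ℂ) • toLevel0 hNL 2 (iota M N q 2 hMN f) := by
  have hq0 : (q : ℂ) ≠ 0 := by exact_mod_cast (Fact.out : q.Prime).ne_zero
  apply DFunLike.ext'
  rw [coe_degeneracyMap0 M L q 2 hML f, CuspForm.IsGLPos.coe_smul, coe_toLevel0, coe_iota, smul_smul]
  norm_num [hq0]

omit [NeZero N] in
/-- `B_{q²} f = q² · ι_q ι_q f` viewed at level `L` (`diag(q²,1) = diag(q,1)²`). [folklore] -/
theorem degeneracyMap0_sq_eq_iota_iota (hMN : M * q ∣ N) (hNL : N * q ∣ L) (hML : M * q ^ 2 ∣ L)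
    (f : CuspForm (Gamma0 M) 2) :
    degeneracyMap0 M L (q ^ 2) 2 f = ((q : ℂ) ^ 2) • iota N L q 2 hNL (iota M N q 2 hMN f) := by
  have hq0 : (q : ℂ) ≠ 0 := by exact_mod_cast (Fact.out : q.Prime).ne_zero
  haveI : NeZero (q ^ 2) := ⟨pow_ne_zero 2 (Fact.out : q.Prime).ne_zero⟩
  have hσ : ∀ c : ℂ, σ (tpD q) c = c := fun c ↦
    σ_eq_self (by rw [det_tpD]; exact_mod_cast (Fact.out : q.Prime).pos) c
  apply DFunLike.ext'
  rw [coe_degeneracyMap0 M L (q ^ 2) 2 hML f, CuspForm.IsGLPos.coe_smul, coe_iota, coe_iota,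
    ModularForm.smul_slash, hσ, smul_smul, smul_smul, ← SlashAction.slash_mul, ← tpD_sq]
  norm_num
  rw [show (q : ℂ) ^ 2 * (q : ℂ)⁻¹ * (q : ℂ)⁻¹ = 1 by field_simp, one_smul]

/-- **`Tr^{Mq²}_M (B₁ f) = q(q+1)·f`** (`q ∤ M`): `Tr^{Mq²}_{Mq} = q` on level-`Mq` forms and `Tr^{Mq}_M = q + 1`
on level-`M` forms — the index `[Γ₀(M) : Γ₀(Mq²)] = q(q+1)` (`α_* α^*`). [cite: DiamondShurman2005, §5.1 p. 166 case (3)] -/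
theorem restrictLevel_restrictLevel_degeneracyMap0_one (hN : N = M * q) (hL : L = N * q) (hqM : ¬ q ∣ M)
    (f : CuspForm (Gamma0 M) 2) :
    restrictLevel (Gamma0 N) (Gamma0 M) 2 (restrictLevel (Gamma0 L) (Gamma0 N) 2 (degeneracyMap0 M L 1 2 f)) =
      ((q : ℂ) * ((q : ℂ) + 1)) • f := by
  have hqN : q ∣ N := ⟨M, by rw [hN, mul_comm]⟩
  have hML : M ∣ L := ⟨q * q, by rw [hL, hN, mul_assoc]⟩
  have h1 : degeneracyMap0 M L 1 2 f = toLevel0 ⟨q, hL⟩ 2 (toLevel0 ⟨q, hN⟩ 2 f) := by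
    rw [degeneracyMap0_one_eq_toLevel0 hML]; rfl
  rw [h1, restrictLevel_toLevel0 2 q N L hL hqN, map_smul, restrictLevel_toLevel0_prime q hN hqM, smul_smul]

/-- **`Tr^{Mq²}_M (B_q f) = q·T_q f`** (`q ∤ M`; `β_* α^* = q T_q`). [cite: Li1975, §2 Lemma 1] -/
theorem restrictLevel_restrictLevel_degeneracyMap0_prime (hN : N = M * q) (hL : L = N * q) (hqM : ¬ q ∣ M)
    (f : CuspForm (Gamma0 M) 2) :
    restrictLevel (Gamma0 N) (Gamma0 M) 2 (restrictLevel (Gamma0 L) (Gamma0 N) 2 (degeneracyMap0 M L q 2 f)) =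
      (q : ℂ) • heckeT (Gamma0 M) 2 q f := by
  have hq0 : (q : ℂ) ≠ 0 := by exact_mod_cast (Fact.out : q.Prime).ne_zero
  have hqN : q ∣ N := ⟨M, by rw [hN, mul_comm]⟩
  have hMN : M * q ∣ N := by rw [hN]
  have hML : M * q ∣ L := ⟨q, by rw [hL, hN]⟩
  rw [degeneracyMap0_prime_eq_toLevel0_iota q hMN ⟨q, hL⟩ hML f, map_smul,
    restrictLevel_toLevel0 2 q N L hL hqN, map_smul, map_smul, restrictLevel_iota_prime q hN hqM hMN f,
    smul_smul, smul_smul]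
  congr 1
  field_simp

/-- **`Tr^{Mq²}_M (B_{q²} f) = T_q(T_q f) − (q+1)·f`** (`q ∤ M`; `γ_* α^* = T_q² − q − 1 = T(1,q²)`).
[cite: Shimura1971, §3.4 (3.4.4)] -/
theorem restrictLevel_restrictLevel_degeneracyMap0_sq (hN : N = M * q) (hL : L = N * q) (hqM : ¬ q ∣ M)
    (f : CuspForm (Gamma0 M) 2) :
    restrictLevel (Gamma0 N) (Gamma0 M) 2
        (restrictLevel (Gamma0 L) (Gamma0 N) 2 (degeneracyMap0 M L (q ^ 2) 2 f)) =
      heckeT (Gamma0 M) 2 q (heckeT (Gamma0 M) 2 q f) - ((q : ℂ) + 1) • f := by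
  have hq0 : (q : ℂ) ≠ 0 := by exact_mod_cast (Fact.out : q.Prime).ne_zero
  have hMN : M * q ∣ N := by rw [hN]
  have hNL : N * q ∣ L := by rw [hL]
  have hML : M * q ^ 2 ∣ L := ⟨1, by rw [hL, hN]; ring⟩
  rw [degeneracyMap0_sq_eq_iota_iota q hMN hNL hML f, map_smul, restrictLevel_iota_iota q hN hL hqM hMN hNL f,
    map_smul, map_sub, map_smul, map_smul, restrictLevel_iota_prime q hN hqM hMN,
    restrictLevel_toLevel0_prime q hN hqM, smul_sub, smul_smul, smul_smul, smul_smul]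
  rw [show (q : ℂ) ^ 2 * (q : ℂ)⁻¹ * (q : ℂ)⁻¹ = 1 by field_simp,
    show (q : ℂ) ^ 2 * ((q : ℂ)⁻¹) ^ 2 = 1 by field_simp, one_smul, one_smul]

end Summit.BirchSwinnertonDyer.BirchSwinnertonDyer.Theorems.TraceDegeneracy

end
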